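/-
Copyright (c) 2026 the pub-hodgecm-mathlib formalisation cell (harness21).  Prover seat hodgecm-mathlib-A-p16 (g32): road «S3-ram», HYP-PLAN v1 (F0P3a-p04 (g19) dealer)
sub-lemma (J-END) for the (V5) assembly of `row_S45_hyperbolic` (F0P3a-p02 (g18)); 2026-09-02.
-/
import Literature.NumberTheory.Automorphic.UnitaryLatticeTreeIsocelesRegionDistanceRamified   -- ★ p847820 DIST (F0P3-p03): depth = content, `dist ≤ 2s'`
import HarnessLib

/-!
# The isoceles region of the ramified type-(1) junction: END VERTICES ARE THE VERTICES OF `u_k`-CONTENT EXACTLY `s'` (Kottwitz 1986 §3; Bruhat–Tits 1972 §10)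

Topic `NumberTheory/Automorphic`; namespace `Literature.NumberTheory.Automorphic.UnitaryLatticeTree`.  THEOREMS ONLY; kernel lane `--supports stmt-HodgeConjecture-24833`;
datum-free.  Cell `pub/hodgecm-mathlib` (D-0151), crux H413; road «S3-ram» (count-neutral Literature seeding); HYP-PLAN v1 94da2402 of F0P3a-p04 (g19), sub-lemma (J-END)
dealt 03:09Z to this seat for the (V5) assembly (F0P3a-p02 (g18)) of the S45 socket `row_S45_hyperbolic` (v4 bc98a4a1 :46).

* `dist_root_eq_two_mul_iff_not_pow_smul_mem_of_frames` (frames form) ∕ **`dist_root_eq_two_mul_iff_not_pow_smul_mem_of_neg`** (tame-ramified form): for a self-dual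
  vertex `v` of the isoceles region (`LEV[v](ϖ^{d₀})`, eigen-data at `i₀`, close-pair gap `ϖ^{d₀+2s'}`, `1 ≤ s'`, `k ≠ i₀`):
  **`dist(r₀, v) = 2s' ↔ ϖ^{s'−1}·u_k ∉ v`** — by ★ `dist_root_le_of_lev_of_frames` (`dist ≤ 2s'`), ★ `dist_root_le_iff_pow_smul_mem_of_frames` at `n = s' − 1`
  and the parity `dist = 2·depth` (★ `dist_root_eq_of_frames`).  This is the END DICHOTOMY `PEND v := dist r₀ v = 2s'` used by ★ p848342 `sum_regionTokens_hyperbolic_pool`.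
HONEST LABEL: HC_CM is proved only modulo the 2 remaining named inputs (hLiu418 24832, h413 24833) until rung 0 closes; nothing printed is asserted here.

## References
* [Kottwitz1986] R. E. Kottwitz, *Base change for unit elements of Hecke algebras*, Compositio Math. 60 (1986), §3 (fixed lattices of a torus element: split lattices of bounded content).
* [BruhatTits1972] F. Bruhat, J. Tits, *Groupes réductifs sur un corps local I*, Publ. Math. IHÉS 41 (1972), §10.
* [Serre1980Trees] J.-P. Serre, *Trees* (1980), Ch. II §1.1 (distance from a base lattice).
* [Tits1979] J. Tits, *Reductive groups over local fields*, PSPM 33.1 (1979), §3.5.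
-/

set_option autoImplicit false

noncomputable section

open scoped Valued WithZero Matrix MatrixGroups

namespace Literature.NumberTheory.Automorphic.UnitaryLatticeTree

open Literature.NumberTheory.Automorphic Literature.NumberTheory.Automorphic.HermitianLattice

variable {K : Type*} [Field K] [Valued K ℤᵐ⁰] {σ : K →+* K} {ϖ : K}

/-- **END DICHOTOMY (frames form)**: a self-dual region vertex `v` (`LEV[v](ϖ^{d₀})`, isoceles eigen-data at `i₀`, gap `ϖ^{d₀+2s'}`, `1 ≤ s'`, `k ≠ i₀`) is at distance
EXACTLY `2s'` from the root iff `ϖ^{s'−1}·u_k ∉ v`. [cite: Kottwitz1986, §3] [cite: BruhatTits1972, §10] [cite: Serre1980Trees, II.1.1] -/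
theorem dist_root_eq_two_mul_iff_not_pow_smul_mem_of_frames (hσ : ∀ x, σ (σ x) = x) (hvσ : ∀ a, Valued.v (σ a) = Valued.v a) (hϖ : Valued.v ϖ = WithZero.exp (-1 : ℤ))
    (hfr₀ : ∀ L : Submodule 𝒪[K] (Fin 3 → K), IsSelfDualLattice σ ϖ ((StdForm.antidiagonal 3).over K) L → ∃ κ : unitaryGroupOfForm σ ((StdForm.antidiagonal 3).over K), κ ∈ unitaryInt σ ((StdForm.antidiagonal 3).over K) ∧ ∃ a : ℤ, L = mapGL (κ : GL (Fin 3) K) (latt (Matrix.diagonal ![ϖ ^ a, 1, ϖ ^ (-a)])))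
    (hfr₂ : ∀ M : Submodule 𝒪[K] (Fin 3 → K), IsVertexLattice σ ϖ ((StdForm.antidiagonal 3).over K) 2 M → ∃ κ : unitaryGroupOfForm σ ((StdForm.antidiagonal 3).over K), κ ∈ unitaryInt σ ((StdForm.antidiagonal 3).over K) ∧ ∃ κ'' : unitaryGroupOfForm σ ((StdForm.antidiagonal 3).over K), κ'' ∈ unitaryInt σ ((StdForm.antidiagonal 3).over K) ∧ ∃ a : ℕ, ∃ t : unitaryGroupOfForm σ ((StdForm.antidiagonal 3).over K), ((t : GL (Fin 3) K) : Matrix (Fin 3) (Fin 3) K) = Matrix.diagonal ![ϖ ^ (a : ℤ), 1, (σ ϖ) ^ (-(a : ℤ))] ∧ M = mapGL (κ : GL (Fin 3) K) (mapGL (t : GL (Fin 3) K) (mapGL (κ'' : GL (Fin 3) K) (latt (Matrix.diagonal ![(1 : K), 1, ϖ])))))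
    (A : GL (Fin 3) K) (hA : IsIntMatrix (A : Matrix (Fin 3) (Fin 3) K)) (hA' : IsIntMatrix ((A⁻¹ : GL (Fin 3) K) : Matrix (Fin 3) (Fin 3) K))
    {d : Fin 3 → K} (hd : ∀ i, Valued.v (d i) = 1) (hdA : Matrix.diagonal d = (-(Matrix.diagonal d).det) • formCongr σ A ((StdForm.antidiagonal 3).over K))
    (s : Fin 3 → K) {γm : Matrix (Fin 3) (Fin 3) K} (hγA : γm = (A : Matrix (Fin 3) (Fin 3) K) * Matrix.diagonal s * ((A⁻¹ : GL (Fin 3) K) : Matrix (Fin 3) (Fin 3) K))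
    (i₀ : Fin 3) {d₀ : ℕ} (he : ∀ i, Valued.v (s i - 1) ≤ Valued.v ϖ ^ d₀) (hiso : ∀ m, m ≠ i₀ → Valued.v (s i₀ - s m) = Valued.v ϖ ^ d₀) {s' : ℕ}
    (hgap : ∀ j k, j ≠ i₀ → k ≠ i₀ → j ≠ k → Valued.v (s j - s k) = Valued.v ϖ ^ (d₀ + 2 * s')) (hs' : 1 ≤ s')
    {v : {M : Submodule 𝒪[K] (Fin 3 → K) // IsVertex σ ϖ ((StdForm.antidiagonal 3).over K) M}} (hv : IsSelfDualLattice σ ϖ ((StdForm.antidiagonal 3).over K) v.1)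
    (hlev : v.1.map ((Matrix.toLin' (γm - 1)).restrictScalars 𝒪[K]) ≤ scaleLattice (ϖ ^ d₀) v.1) {k : Fin 3} (hk : k ≠ i₀) :
    (latticeGraph σ ϖ ((StdForm.antidiagonal 3).over K)).dist ⟨stdLattice K 3, 0, isSelfDualLattice_stdLattice_three_of_v hϖ⟩ v = 2 * s' ↔
      ¬ ϖ ^ (s' - 1) • ((A : Matrix (Fin 3) (Fin 3) K) *ᵥ Pi.single k 1) ∈ v.1 := by
  have hle := dist_root_le_of_lev_of_frames hσ hvσ hϖ hfr₀ hfr₂ A hA hA' hd hdA s hγA i₀ he hiso hgap hv hlev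
  obtain ⟨hu, -⟩ := (map_sub_one_le_scaleLattice_iff_mem_and_mem_of_isSelfDualLattice hσ hvσ hϖ A hd hdA s hγA i₀ he hiso hgap hv hk).1 hlev
  have hiff := dist_root_le_iff_pow_smul_mem_of_frames hσ hvσ hϖ hfr₀ hfr₂ A hA hA' hd hdA hv hk hu (s' - 1)
  have heven := dist_root_eq_of_frames hσ hvσ hϖ hfr₀ hfr₂ v
  rw [if_pos hv] at heven
  constructor
  · intro h hm
    have := hiff.2 hm
    omega
  · intro hm
    have h' : ¬ (latticeGraph σ ϖ ((StdForm.antidiagonal 3).over K)).dist ⟨stdLattice K 3, 0, isSelfDualLattice_stdLattice_three_of_v hϖ⟩ v ≤ 2 * (s' - 1) :=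
      fun h => hm (hiff.1 h)
    omega

/-- **END DICHOTOMY, tame-ramified form** (frames discharged as in ★ `dist_root_le_of_lev_of_neg`): for a self-dual vertex `v` with `LEV[v](ϖ^{d₀})` in the isoceles
configuration (`1 ≤ s'`, `k ≠ i₀`): `dist(r₀, v) = 2s' ↔ ϖ^{s'−1}·u_k ∉ v` — the `PEND` predicate of the hyperbolic pooling.
[cite: Kottwitz1986, §3] [cite: BruhatTits1972, §10] [cite: Tits1979, §3.5] -/
theorem dist_root_eq_two_mul_iff_not_pow_smul_mem_of_neg (hσ : ∀ x, σ (σ x) = x) (hvσ : ∀ a, Valued.v (σ a) = Valued.v a) (hσϖ : σ ϖ = -ϖ)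
    (hϖ : Valued.v ϖ = WithZero.exp (-1 : ℤ)) (hres : ∀ x : K, Valued.v x ≤ 1 → Valued.v (σ x - x) < 1) (h2 : Valued.v (2 : K) = 1)
    (hnorm : ∀ u : K, σ u = u → Valued.v (u - 1) < 1 → ∃ z : K, z * σ z = u ∧ Valued.v (z - 1) ≤ Valued.v (u - 1)) [Finite 𝓀[K]]
    [ValuativeRel K] [(Valued.v : Valuation K ℤᵐ⁰).Compatible]
    (A : GL (Fin 3) K) (hA : IsIntMatrix (A : Matrix (Fin 3) (Fin 3) K)) (hA' : IsIntMatrix ((A⁻¹ : GL (Fin 3) K) : Matrix (Fin 3) (Fin 3) K))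
    {d : Fin 3 → K} (hd : ∀ i, Valued.v (d i) = 1) (hdA : Matrix.diagonal d = (-(Matrix.diagonal d).det) • formCongr σ A ((StdForm.antidiagonal 3).over K))
    (s : Fin 3 → K) {γm : Matrix (Fin 3) (Fin 3) K} (hγA : γm = (A : Matrix (Fin 3) (Fin 3) K) * Matrix.diagonal s * ((A⁻¹ : GL (Fin 3) K) : Matrix (Fin 3) (Fin 3) K))
    (i₀ : Fin 3) {d₀ : ℕ} (he : ∀ i, Valued.v (s i - 1) ≤ Valued.v ϖ ^ d₀) (hiso : ∀ m, m ≠ i₀ → Valued.v (s i₀ - s m) = Valued.v ϖ ^ d₀) {s' : ℕ}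
    (hgap : ∀ j k, j ≠ i₀ → k ≠ i₀ → j ≠ k → Valued.v (s j - s k) = Valued.v ϖ ^ (d₀ + 2 * s')) (hs' : 1 ≤ s')
    {v : {M : Submodule 𝒪[K] (Fin 3 → K) // IsVertex σ ϖ ((StdForm.antidiagonal 3).over K) M}} (hv : IsSelfDualLattice σ ϖ ((StdForm.antidiagonal 3).over K) v.1)
    (hlev : v.1.map ((Matrix.toLin' (γm - 1)).restrictScalars 𝒪[K]) ≤ scaleLattice (ϖ ^ d₀) v.1) {k : Fin 3} (hk : k ≠ i₀) :
    (latticeGraph σ ϖ ((StdForm.antidiagonal 3).over K)).dist ⟨stdLattice K 3, 0, isSelfDualLattice_stdLattice_three_of_v hϖ⟩ v = 2 * s' ↔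
      ¬ ϖ ^ (s' - 1) • ((A : Matrix (Fin 3) (Fin 3) K) *ᵥ Pi.single k 1) ∈ v.1 := by
  refine dist_root_eq_two_mul_iff_not_pow_smul_mem_of_frames hσ hvσ hϖ (fun L hL => ?_) (fun M hM => ?_) A hA hA' hd hdA s hγA i₀ he hiso hgap hs' hv hlev hk
  · obtain ⟨u, rfl⟩ := exists_unitary_mapGL_stdLattice_eq_of_isSelfDualLattice_of_v_two hσ hvσ hϖ h2 hL
    exact exists_frame_mapGL_stdLattice hσ hvσ hϖ u
  · obtain ⟨u, rfl⟩ := forall_isVertexLattice_two_exists_mapGL_N₁_eq_of_neg hσ hvσ hϖ hσϖ hres h2 hnorm M hM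
    exact exists_frame_mapGL_N₁ hσ hvσ hϖ u

end Literature.NumberTheory.Automorphic.UnitaryLatticeTree

end
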